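import Summits.BirchSwinnertonDyer.Rank1Residual.X9.LeafDischargeHowardBDP
import Summits.BirchSwinnertonDyer.Rank1Residual.Partition.MainConjecturesIrreducibleIdentityRows
import HarnessLib

/-!
# Classes X9 / X10b: the Summits-side anticyclotomic LINKS and the Heegner-index identity over `K`
# WITHOUT surjectivity — the doors of the Tamagawa-free identity road on the leaves (file R)

Print-tier cell `bsd-print-x9` (D-0131 (2), key `x9`), typer seat ty2, file R of the discharge
interface; sequel of file Q `X9/LeafDischargeHowardBDP` (Howard's data exist; Howard's containment
and the INTEGRAL anticyclotomic identity at `𝟙` on X9 / X10b Heegner frames from the Yan–Zhu composite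
`h57` ∘ Mastella–Zerman Cor. 4.6 `h46`). THEOREMS ONLY: no definition, no new named fact (D-0014 /
D-0026); nothing here is a class theorem; X9 and X10b keep their labels.

## What this file records — binder-for-binder the (sur) road's doors with `(h124, 3 < p, GoodOrd,
## Surj, irr_K)` REPLACED by `(h57, h46, ClassX9 W p, p ∤ h_K)` (X10b: `ClassX10 W p`, `¬ Surj W 3`, non-CM)

1. §1 `ClassX9.imcWaldspurgerOnTreeGoodAt_of_yz26_of_cor46` — `X11b.IMCWaldspurgerOnTreeGoodAt p κ v̄
   γ ι P` (CGLS letter) GIVEN a generator with non-zero constant term (the X9 reading of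
   `X11b.imcWaldspurgerOnTreeGoodAt_of_thm124b`); `…_of_thm331` — generator from JSW 2017 Thm. 3.3.1
   at `embAt v̄`; `ClassX9.imcWaldspurgerOnTreeGoodAt_inducedPlace_of_yz26_of_cor46_of_thm331` — the
   JSW / Castella letter at `inducedPlace ι` for EVERY embedding `ι`, through the σ-bridge (the X9
   reading of `X11b.imcWaldspurgerOnTreeGoodAt_inducedPlace_of_thm124b_of_thm331`, THE door of the
   identity road); the X10b twins.
2. §2 `ClassX9.indexIdentityAt_of_heegner_of_yz26_of_cor46_of_thm331` — the `p`-part of BSD for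
   `E/K` in Gross–Zagier's shape (`X11b.IndexIdentityAt W p K P_K`: `2·ord_p ∏ c_ℓ + ord_p #Ш(E/K) =
   2·ord_p [E(K):ℤP_K]`) at EVERY classical Manin-unit Heegner datum of an X9 pair with `ord_{s=1}
   L(E,s) = 1` and `p ∤ h_K`, NO Tamagawa proviso, NO image certificate, NO Jetchev input — the X9
   reading of `X11b.indexIdentityAt_of_heegner_of_thm124b_of_thm331`; its X10b twin at `p = 3`
   (replacing Yan–Zhu 4.12's (Im)-at-`3` of `X11b.indexIdentityAt_of_heegner_of_thm412_of_thm331`).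

From §2 the provers' class-level assembly is the existing one
(`bsdp_rankOne_of_indexIdentityAt_of_twist_mazurMainConjecture` /
`RowC2.bsdp_of_publishedFacts_of_identityLink` pattern) with the twist's rank-`0` input. Inputs beyond
the leaf predicate and the frame: `h57` (flag `YZ26-57i+59+BCS422+CGLS513-composite`; at `3` also
`YZ26@3-BF-ERL-Ohta`), `h46` (PUB), `h331` (PUB), and for §2 `hGZ`, `hKo`, `hmod`, `hGZK`.

## References

* [YanZhu2024MainConjNonCM] J. Algebra 693 (2026) = arXiv:2412.20078, Thm. 5.7 (1), Thm. 5.9, §5.2.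
* [BurungaleCastellaSkinner2025] IMRN 2025 = arXiv:2405.00270v2, Prop. 4.2.2, Cor. 1.3.1 (proof, p. 4).
* [CastellaGrossiLeeSkinner2022] Invent. Math. 227 (2022), Thm. 5.1.3.
* [MastellaZerman2026] arXiv:2505.08710, Cor. 4.6. [LombardoTronto2022] PJM 320, Thm. 3.16, Prop. 3.12.
* [JetchevSkinnerWan2017] Camb. J. Math. 5 (2017), Thm. 3.3.1, §3.5, §7.3.1, §7.4.1.
* [Castella2018] Math. Ann., Thm. 2.3, §5 (5.3); [GrossLMS1991] §2 (2.2); [Kolyvagin1990] Thm. A.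
* Tree: file Q; `Partition/MainConjecturesIrreducibleBDP.lean` §1–§3 and
  `Partition/MainConjecturesIrreducibleIdentityRows.lean` §1 (the (sur) templates, followed line by
  line).
-/

set_option autoImplicit false

noncomputable section

open scoped Classical

open WeierstrassCurve NumberField IsDedekindDomain Literature.NumberTheory.EllipticCurves
  Literature.NumberTheory.EllipticCurves.ModularForms Literature.NumberTheory.Automorphic
  Literature.NumberTheory.EllipticCurves.Rank1Residual
  Literature.NumberTheory.EllipticCurves.YanZhu2026
  Literature.NumberTheory.EllipticCurves.BurungaleCastellaSkinner2025
  Literature.NumberTheory.EllipticCurves.CastellaGrossiLeeSkinner2022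
  Literature.NumberTheory.EllipticCurves.JetchevSkinnerWan2017
  Literature.NumberTheory.EllipticCurves.MastellaZerman2026
  Summit.BirchSwinnertonDyer.BirchSwinnertonDyer.Theorems.Rank1ResidualX1Defs

/-! ## §1 The Summits-side anticyclotomic links on X9 / X10b frames, binder-for-binder the (sur) road's -/

namespace Summit.BirchSwinnertonDyer.Rank1Residual

namespace X11b

section Links

variable {W : WeierstrassCurve ℚ} [W.IsElliptic] [W.IsGloballyMinimal] {p : ℕ} [Fact p.Prime]
  {K : Type} [Field K] [NumberField K]

/-- **`X11b.IMCWaldspurgerOnTreeGoodAt p κ v̄ γ ι P` on X9 Heegner frames (CGLS letter), NO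
surjectivity**: the X9 reading of `imcWaldspurgerOnTreeGoodAt_of_thm124b` — `(h124, 3 < p, GoodOrd, Surj)`
replaced by `(h57, h46, ClassX9 W p, p ∤ h_K)`; per-frame data as there (Manin-unit parametrisation
`p ∤ c_E`, so the Manin term vanishes), GIVEN one generator `G` of `ch_Λ(X_Gr)` with `G(0) ≠ 0`.
[cite: YanZhu2024MainConjNonCM, Thm. 5.7 (1) and Thm. 5.9] [cite: CastellaGrossiLeeSkinner2022, Thm. 5.1.3]
[cite: MastellaZerman2026, Cor. 4.6] [cite: Castella2018, §5 (eq:IMC+BDP) (arXiv:1704.06608 p. 12)] -/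
theorem _root_.Literature.NumberTheory.EllipticCurves.Rank1Residual.ClassX9.imcWaldspurgerOnTreeGoodAt_of_yz26_of_cor46
    (h57 : thm57_thm59_bcs422_cgls513_generator_constantCoeff_of_heegnerDivisibility)
    (h46 : cor46_howardDivisibility_of_scalarImage.{0}) (h : ClassX9 W p)
    (hK : IsImaginaryQuadratic K) (hodd : Odd (NumberField.discr K)) (h3 : NumberField.discr K ≠ -3)
    {N : ℕ} [NeZero N] (hN : W.conductorNorm ℤ = N) (hHN : SatisfiesHeegnerHypothesis N K)
    (hHp : SatisfiesHeegnerHypothesis p K) (hh : ¬ p ∣ NumberField.classNumber K)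
    (ι : K →+* ℚ_[p]) (v vbar : HeightOneSpectrum (𝓞 K))
    (hv : ∀ x : 𝓞 K, x ∈ v.asIdeal ↔ ‖ι (x : K)‖ < 1)
    (hvbar : ((p : ℕ) : 𝓞 K) ∈ vbar.asIdeal) (hne : vbar ≠ v)
    (κ : ZpExtension K p) (hκ : κ.IsAnticyclotomic)
    (γ : Field.absoluteGaloisGroup K) [Fact (κ.IsTopGenerator γ)]
    (Dt : ModularParametrizationData W N) (hc : ¬ (p : ℤ) ∣ Dt.c)
    (H : HeegnerDatum N (NumberField.discr K)) (ιC : K →+* ℂ) (P : (W.baseChange K).toAffine.Point)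
    (hP : WeierstrassCurve.Affine.Point.map ιC.toRatAlgHom P = heegnerPointComplex Dt H)
    (G : IwasawaAlgebra p)
    (hG : Literature.NumberTheory.EllipticCurves.Castella2018.AcSelmer.XAc.charIdeal (W.baseChange K) p
      κ vbar ∅ γ = Ideal.span {G})
    (hG0 : PowerSeries.constantCoeff G ≠ 0) :
    IMCWaldspurgerOnTreeGoodAt p κ vbar γ ι P := by
  obtain ⟨n, hn, hval⟩ := h.hasCharValuationAt_of_yz26_of_cor46 h57 h46 hK hodd h3 hN hHN hHp hh ι v
    vbar hv hvbar hne κ hκ γ Dt H ιC P hP G hG hG0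
  have hc0 : padicValInt p Dt.c = 0 := padicValInt.eq_zero_of_not_dvd hc
  refine ⟨n, (AcSelmer.hasCharValuationAt_iff_literature _ p κ vbar ∅ γ n).mpr hn, ?_⟩
  rw [padicLogOrd_eq_literature]
  omega

/-- **(IMC∘BDP)ᵍ on X9 Heegner frames, CGLS letter, generator from JSW 2017 Thm. 3.3.1** at THE
embedding `embAt v̄` (which induces `v̄`), in rank one with `#Ш(E/K)[p^∞] < ∞` and `P` non-torsion
(carried); (irr_K) for JSW from the leaf IN THE KERNEL (`ClassX9.irr_baseChange_of_heegner`). The X9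
reading of `imcWaldspurgerOnTreeGoodAt_of_thm124b_of_thm331`.
[cite: YanZhu2024MainConjNonCM, Thm. 5.7 (1) and Thm. 5.9] [cite: MastellaZerman2026, Cor. 4.6]
[cite: CastellaGrossiLeeSkinner2022, Thm. 5.1.3] [cite: JetchevSkinnerWan2017, Thm. 3.3.1] -/
theorem _root_.Literature.NumberTheory.EllipticCurves.Rank1Residual.ClassX9.imcWaldspurgerOnTreeGoodAt_of_yz26_of_cor46_of_thm331
    (h57 : thm57_thm59_bcs422_cgls513_generator_constantCoeff_of_heegnerDivisibility)
    (h46 : cor46_howardDivisibility_of_scalarImage.{0}) (h331 : thm331_anticyclotomicControl)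
    (h : ClassX9 W p)
    (hK : IsImaginaryQuadratic K) (hodd : Odd (NumberField.discr K)) (h3 : NumberField.discr K ≠ -3)
    {N : ℕ} [NeZero N] (hN : W.conductorNorm ℤ = N) (hHN : SatisfiesHeegnerHypothesis N K)
    (hHp : SatisfiesHeegnerHypothesis p K) (hh : ¬ p ∣ NumberField.classNumber K)
    (ι : K →+* ℚ_[p]) (v vbar : HeightOneSpectrum (𝓞 K))
    (hv : ∀ x : 𝓞 K, x ∈ v.asIdeal ↔ ‖ι (x : K)‖ < 1)
    (hvbar : ((p : ℕ) : 𝓞 K) ∈ vbar.asIdeal) (hne : vbar ≠ v)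
    (κ : ZpExtension K p) (hκ : κ.IsAnticyclotomic)
    (γ : Field.absoluteGaloisGroup K) [Fact (κ.IsTopGenerator γ)]
    (Dt : ModularParametrizationData W N) (hc : ¬ (p : ℤ) ∣ Dt.c)
    (H : HeegnerDatum N (NumberField.discr K)) (ιC : K →+* ℂ) (P : (W.baseChange K).toAffine.Point)
    (hP : WeierstrassCurve.Affine.Point.map ιC.toRatAlgHom P = heegnerPointComplex Dt H)
    (hrk : (W.baseChange K).mordellWeilRank = 1)
    (hfinp : Finite (AddCommGroup.primaryComponent (W.baseChange K).sha p))
    (hPinf : ¬ IsOfFinAddOrder P) :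
    IMCWaldspurgerOnTreeGoodAt p κ vbar γ ι P := by
  have hHN' : SatisfiesHeegnerHypothesis (W.conductorNorm ℤ) K := by rw [hN]; exact hHN
  -- `v̄` has degree one (`p` splits in the quadratic `K`), so `embAt v̄ : K ↪ ℚ_p` induces `v̄`
  have hsplit : SplitsIn K p := hHp p Fact.out (dvd_refl p)
  obtain ⟨he, hf⟩ := degreeOne_of_splitsIn hK.1 hsplit hvbar
  obtain ⟨-, F, hF, hF0, -⟩ := h331 W p h.three_le h.good K hK hHp hHN'
    (h.irr_baseChange_of_heegner hK hHN' hHp) (embAt K p vbar hvbar he hf) vbar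
    (mem_asIdeal_iff_norm_embAt_lt_one vbar hvbar he hf) κ hκ γ hrk hfinp P hPinf
  exact h.imcWaldspurgerOnTreeGoodAt_of_yz26_of_cor46 h57 h46 hK hodd h3 hN hHN hHp hh ι v vbar hv
    hvbar hne κ hκ γ Dt hc H ιC P hP F hF hF0

/-- **(IMC∘BDP)ᵍ on X9 Heegner frames in the JSW / Castella letter `IMCWaldspurgerOnTreeGoodAt p κ
(inducedPlace ι) γ ι P`**, for EVERY embedding `ι : K ↪ ℚ_p`, in rank one: the composite at the
embedding `embAt w` of the other prime `w` (strict prime `inducedPlace ι`), the JSW generator at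
`(ι, inducedPlace ι)`, and the σ-bridge `embAt w = ι ∘ σ`, `ord_p log_{ι∘σ} P = ord_p log_ι P` in rank
one at `p ≠ 2` (`padicLogOrd_comp_eq_of_rank_one`). The X9 reading of
`imcWaldspurgerOnTreeGoodAt_inducedPlace_of_thm124b_of_thm331` — the door of the identity road.
[cite: YanZhu2024MainConjNonCM, Thm. 5.7 (1) and Thm. 5.9] [cite: MastellaZerman2026, Cor. 4.6]
[cite: CastellaGrossiLeeSkinner2022, Thm. 5.1.3] [cite: JetchevSkinnerWan2017, Thm. 3.3.1, §2.3.2]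
[cite: Castella2018, Thm. 2.3, §5 (eq:IMC+BDP)] -/
theorem _root_.Literature.NumberTheory.EllipticCurves.Rank1Residual.ClassX9.imcWaldspurgerOnTreeGoodAt_inducedPlace_of_yz26_of_cor46_of_thm331
    (h57 : thm57_thm59_bcs422_cgls513_generator_constantCoeff_of_heegnerDivisibility)
    (h46 : cor46_howardDivisibility_of_scalarImage.{0}) (h331 : thm331_anticyclotomicControl)
    (h : ClassX9 W p)
    (hK : IsImaginaryQuadratic K) (hodd : Odd (NumberField.discr K)) (h3 : NumberField.discr K ≠ -3)
    {N : ℕ} [NeZero N] (hN : W.conductorNorm ℤ = N) (hHN : SatisfiesHeegnerHypothesis N K)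
    (hHp : SatisfiesHeegnerHypothesis p K) (hh : ¬ p ∣ NumberField.classNumber K)
    (ι : K →+* ℚ_[p]) (κ : ZpExtension K p) (hκ : κ.IsAnticyclotomic)
    (γ : Field.absoluteGaloisGroup K) [Fact (κ.IsTopGenerator γ)]
    (Dt : ModularParametrizationData W N) (hc : ¬ (p : ℤ) ∣ Dt.c)
    (H : HeegnerDatum N (NumberField.discr K)) (ιC : K →+* ℂ) (P : (W.baseChange K).toAffine.Point)
    (hP : WeierstrassCurve.Affine.Point.map ιC.toRatAlgHom P = heegnerPointComplex Dt H)
    (hrk : (W.baseChange K).mordellWeilRank = 1)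
    (hfinp : Finite (AddCommGroup.primaryComponent (W.baseChange K).sha p))
    (hPinf : ¬ IsOfFinAddOrder P) :
    IMCWaldspurgerOnTreeGoodAt p κ (inducedPlace ι) γ ι P := by
  have hHN' : SatisfiesHeegnerHypothesis (W.conductorNorm ℤ) K := by rw [hN]; exact hHN
  have hirrK : (W.baseChange K).HasIrreducibleModPGaloisRep p := h.irr_baseChange_of_heegner hK hHN' hHp
  -- the other prime `w` above `p`, of degree one, and THE embedding at it
  obtain ⟨w, hw, hwne⟩ := exists_other_prime hHp (inducedPlace ι) (natCast_mem_inducedPlace ι)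
  have hsplit : SplitsIn K p := hHp p Fact.out (dvd_refl p)
  obtain ⟨he, hf⟩ := degreeOne_of_splitsIn hK.1 hsplit hw
  set ιw : K →+* ℚ_[p] := embAt K p w hw he hf with hιw
  -- a generator with non-zero constant term of the module strict at `v = inducedPlace ι`, from JSW
  obtain ⟨-, F, hF, hF0, -⟩ := h331 W p h.three_le h.good K hK hHp hHN' hirrK ι (inducedPlace ι)
    (mem_inducedPlace_iff ι) κ hκ γ hrk hfinp P hPinf
  -- the composite at the embedding `ιw` (inducing `w`), strict prime `inducedPlace ι`
  obtain ⟨n, hn, hval⟩ := h.hasCharValuationAt_of_yz26_of_cor46 h57 h46 hK hodd h3 hN hHN hHp hh ιw w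
    (inducedPlace ι) (mem_asIdeal_iff_norm_embAt_lt_one w hw he hf) (natCast_mem_inducedPlace ι)
    (fun h' ↦ hwne h'.symm) κ hκ γ Dt H ιC P hP F hF hF0
  -- `ιw = ι ∘ σ` for an involution `σ`; the log valuations agree in rank one
  obtain ⟨σ, hσ, hισ⟩ := exists_involutive_comp_eq hK.1 ι ιw
  have hlog : Literature.NumberTheory.EllipticCurves.padicLogOrd W p ιw P = padicLogOrd W p ι P := by
    rw [← hισ, ← padicLogOrd_eq_literature]
    exact padicLogOrd_comp_eq_of_rank_one W p h.ne_two σ hσ ι hrk P hPinf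
  have hc0 : padicValInt p Dt.c = 0 := padicValInt.eq_zero_of_not_dvd hc
  refine ⟨n, (AcSelmer.hasCharValuationAt_iff_literature _ p κ (inducedPlace ι) ∅ γ n).mpr hn, ?_⟩
  rw [hlog] at hval
  omega

/-- **`X11b.IMCWaldspurgerOnTreeGoodAt 3 κ v̄ γ ι P` on X10b Heegner frames (CGLS letter)** — the
X10b twin (`p = 3` split, `¬ Surj W 3`, non-CM), GIVEN a generator with non-zero constant term.
[cite: YanZhu2024MainConjNonCM, Thm. 5.7 (1) and Thm. 5.9 (p > 2)] [cite: MastellaZerman2026, Cor. 4.6]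
[cite: CastellaGrossiLeeSkinner2022, Thm. 5.1.3] [cite: Castella2018, §5 (eq:IMC+BDP)] -/
theorem _root_.Literature.NumberTheory.EllipticCurves.Rank1Residual.ClassX10.imcWaldspurgerOnTreeGoodAt_of_yz26_of_cor46_of_not_surj
    (h57 : thm57_thm59_bcs422_cgls513_generator_constantCoeff_of_heegnerDivisibility)
    (h46 : cor46_howardDivisibility_of_scalarImage.{0}) (h : ClassX10 W p) (hns : ¬ Surj W 3)
    (hCM : ¬ W.HasCM)
    (hK : IsImaginaryQuadratic K) (hodd : Odd (NumberField.discr K)) (h3 : NumberField.discr K ≠ -3)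
    {N : ℕ} [NeZero N] (hN : W.conductorNorm ℤ = N) (hHN : SatisfiesHeegnerHypothesis N K)
    (hHp : SatisfiesHeegnerHypothesis p K) (hh : ¬ p ∣ NumberField.classNumber K)
    (ι : K →+* ℚ_[p]) (v vbar : HeightOneSpectrum (𝓞 K))
    (hv : ∀ x : 𝓞 K, x ∈ v.asIdeal ↔ ‖ι (x : K)‖ < 1)
    (hvbar : ((p : ℕ) : 𝓞 K) ∈ vbar.asIdeal) (hne : vbar ≠ v)
    (κ : ZpExtension K p) (hκ : κ.IsAnticyclotomic)
    (γ : Field.absoluteGaloisGroup K) [Fact (κ.IsTopGenerator γ)]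
    (Dt : ModularParametrizationData W N) (hc : ¬ (p : ℤ) ∣ Dt.c)
    (H : HeegnerDatum N (NumberField.discr K)) (ιC : K →+* ℂ) (P : (W.baseChange K).toAffine.Point)
    (hP : WeierstrassCurve.Affine.Point.map ιC.toRatAlgHom P = heegnerPointComplex Dt H)
    (G : IwasawaAlgebra p)
    (hG : Literature.NumberTheory.EllipticCurves.Castella2018.AcSelmer.XAc.charIdeal (W.baseChange K) p
      κ vbar ∅ γ = Ideal.span {G})
    (hG0 : PowerSeries.constantCoeff G ≠ 0) :
    IMCWaldspurgerOnTreeGoodAt p κ vbar γ ι P := by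
  obtain ⟨n, hn, hval⟩ := h.hasCharValuationAt_of_yz26_of_cor46_of_not_surj h57 h46 hns hCM hK hodd
    h3 hN hHN hHp hh ι v vbar hv hvbar hne κ hκ γ Dt H ιC P hP G hG hG0
  have hc0 : padicValInt p Dt.c = 0 := padicValInt.eq_zero_of_not_dvd hc
  refine ⟨n, (AcSelmer.hasCharValuationAt_iff_literature _ p κ vbar ∅ γ n).mpr hn, ?_⟩
  rw [padicLogOrd_eq_literature]
  omega

/-- **(IMC∘BDP)ᵍ on X10b Heegner frames in the JSW letter `IMCWaldspurgerOnTreeGoodAt 3 κ (inducedPlace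
ι) γ ι P`**, every embedding `ι`, in rank one (generator from JSW 3.3.1, typed at `p ≥ 3`; σ-bridge at
`3 ≠ 2`). The X10b twin of the door of the identity road.
[cite: YanZhu2024MainConjNonCM, Thm. 5.7 (1) and Thm. 5.9 (p > 2)] [cite: MastellaZerman2026, Cor. 4.6]
[cite: CastellaGrossiLeeSkinner2022, Thm. 5.1.3] [cite: JetchevSkinnerWan2017, Thm. 3.3.1 (p ≥ 3)]
[cite: Castella2018, Thm. 2.3, §5 (eq:IMC+BDP)] -/
theorem _root_.Literature.NumberTheory.EllipticCurves.Rank1Residual.ClassX10.imcWaldspurgerOnTreeGoodAt_inducedPlace_of_yz26_of_cor46_of_thm331_of_not_surj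
    (h57 : thm57_thm59_bcs422_cgls513_generator_constantCoeff_of_heegnerDivisibility)
    (h46 : cor46_howardDivisibility_of_scalarImage.{0}) (h331 : thm331_anticyclotomicControl)
    (h : ClassX10 W p) (hns : ¬ Surj W 3) (hCM : ¬ W.HasCM)
    (hK : IsImaginaryQuadratic K) (hodd : Odd (NumberField.discr K)) (h3 : NumberField.discr K ≠ -3)
    {N : ℕ} [NeZero N] (hN : W.conductorNorm ℤ = N) (hHN : SatisfiesHeegnerHypothesis N K)
    (hHp : SatisfiesHeegnerHypothesis p K) (hh : ¬ p ∣ NumberField.classNumber K)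
    (ι : K →+* ℚ_[p]) (κ : ZpExtension K p) (hκ : κ.IsAnticyclotomic)
    (γ : Field.absoluteGaloisGroup K) [Fact (κ.IsTopGenerator γ)]
    (Dt : ModularParametrizationData W N) (hc : ¬ (p : ℤ) ∣ Dt.c)
    (H : HeegnerDatum N (NumberField.discr K)) (ιC : K →+* ℂ) (P : (W.baseChange K).toAffine.Point)
    (hP : WeierstrassCurve.Affine.Point.map ιC.toRatAlgHom P = heegnerPointComplex Dt H)
    (hrk : (W.baseChange K).mordellWeilRank = 1)
    (hfinp : Finite (AddCommGroup.primaryComponent (W.baseChange K).sha p))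
    (hPinf : ¬ IsOfFinAddOrder P) :
    IMCWaldspurgerOnTreeGoodAt p κ (inducedPlace ι) γ ι P := by
  have hHN' : SatisfiesHeegnerHypothesis (W.conductorNorm ℤ) K := by rw [hN]; exact hHN
  have hirrK : (W.baseChange K).HasIrreducibleModPGaloisRep p := h.irr_baseChange_of_heegner hK hHN' hHp
  obtain ⟨w, hw, hwne⟩ := exists_other_prime hHp (inducedPlace ι) (natCast_mem_inducedPlace ι)
  have hsplit : SplitsIn K p := hHp p Fact.out (dvd_refl p)
  obtain ⟨he, hf⟩ := degreeOne_of_splitsIn hK.1 hsplit hw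
  set ιw : K →+* ℚ_[p] := embAt K p w hw he hf with hιw
  obtain ⟨-, F, hF, hF0, -⟩ := h331 W p h.three_le h.goodOrd.1 K hK hHp hHN' hirrK ι (inducedPlace ι)
    (mem_inducedPlace_iff ι) κ hκ γ hrk hfinp P hPinf
  obtain ⟨n, hn, hval⟩ := h.hasCharValuationAt_of_yz26_of_cor46_of_not_surj h57 h46 hns hCM hK hodd
    h3 hN hHN hHp hh ιw w (inducedPlace ι) (mem_asIdeal_iff_norm_embAt_lt_one w hw he hf)
    (natCast_mem_inducedPlace ι) (fun h' ↦ hwne h'.symm) κ hκ γ Dt H ιC P hP F hF hF0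
  obtain ⟨σ, hσ, hισ⟩ := exists_involutive_comp_eq hK.1 ι ιw
  have hlog : Literature.NumberTheory.EllipticCurves.padicLogOrd W p ιw P = padicLogOrd W p ι P := by
    rw [← hισ, ← padicLogOrd_eq_literature]
    exact padicLogOrd_comp_eq_of_rank_one W p h.ne_two σ hσ ι hrk P hPinf
  have hc0 : padicValInt p Dt.c = 0 := padicValInt.eq_zero_of_not_dvd hc
  refine ⟨n, (AcSelmer.hasCharValuationAt_iff_literature _ p κ (inducedPlace ι) ∅ γ n).mpr hn, ?_⟩
  rw [hlog] at hval
  omega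

end Links

/-! ## §2 The Heegner-index identity over `K` at a datum of an X9 / X10b pair, NO Tamagawa proviso -/

section Datum

variable (W : WeierstrassCurve ℚ) [W.IsElliptic] [W.IsGloballyMinimal] (p : ℕ) [Fact p.Prime]
  (N : ℕ) [NeZero N] (K : Type) [Field K] [NumberField K]
  (Dt : ModularParametrizationData W N) (H : HeegnerDatum N (NumberField.discr K)) (ιC : K →+* ℂ)
  (P : (W.baseChange K).toAffine.Point)

/-- **The `p`-part of BSD for `E/K` in Gross–Zagier's shape on class X9 — `2·ord_p ∏_ℓ c_ℓ(E) +
ord_p #Ш(E/K) = 2·ord_p [E(K):ℤP_K]` (`X11b.IndexIdentityAt W p K P`) — at EVERY classical Manin-unit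
Heegner datum of an X9 pair `(E, p)` with `ord_{s=1} L(E,s) = 1` and `p ∤ h_K`, NO Tamagawa proviso, NO
image certificate, NO Jetchev input**: the X9 reading of `indexIdentityAt_of_heegner_of_thm124b_of_thm331`,
with the TWO-SIDED link from `ClassX9.imcWaldspurgerOnTreeGoodAt_inducedPlace_of_yz26_of_cor46_of_thm331`
(Yan–Zhu ∘ BCS ∘ CGLS granted Howard, Howard from Mastella–Zerman) and (CTL)ᵍ from JSW 3.3.1; rank one
and finiteness over `K` by GZK + Kolyvagin, `P_K` non-torsion by Gross–Zagier, (irr_K) from the leaf.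
Inputs beyond the leaf predicate and the frame: the named facts `h57` (composite flag
`YZ26-57i+59+BCS422+CGLS513-composite`), `h46`, `h331`, `hGZ`, `hKo`, `hmod`, `hGZK`.
[cite: BurungaleCastellaSkinner2025, proof of Cor. 1.3.1 (p. 4) ("the p-part of the BSD formula for E/K")]
[cite: YanZhu2024MainConjNonCM, Thm. 5.7 (1), Thm. 5.9] [cite: MastellaZerman2026, Cor. 4.6]
[cite: JetchevSkinnerWan2017, Thm. 3.3.1 with §3.5 (3.5.d), §7.3.1 (eq:tamK)]
[cite: CastellaGrossiLeeSkinner2022, Thm. 5.1.3] [cite: Castella2018, §5 (5.3)] [cite: GrossLMS1991, §2 Conj. (2.2)]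
[cite: Kolyvagin1990, Thm. A] -/
theorem _root_.Literature.NumberTheory.EllipticCurves.Rank1Residual.ClassX9.indexIdentityAt_of_heegner_of_yz26_of_cor46_of_thm331
    (h57 : thm57_thm59_bcs422_cgls513_generator_constantCoeff_of_heegnerDivisibility)
    (h46 : cor46_howardDivisibility_of_scalarImage.{0}) (h331 : thm331_anticyclotomicControl)
    (hGZ : gross_zagier N W K) (hKo : kolyvagin N W K) (hmod : hasEntireLFunction_rat)
    (hGZK : rank_eq_analyticRank_of_analyticRank_le_one)
    (h : ClassX9 W p) (hr : W.analyticRank = 1)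
    (hN : W.conductorNorm ℤ = N) (hK : IsImaginaryQuadratic K) (hodd : Odd (NumberField.discr K))
    (h3 : NumberField.discr K ≠ -3) (hHN : SatisfiesHeegnerHypothesis N K)
    (hHp : SatisfiesHeegnerHypothesis p K) (hh : ¬ p ∣ NumberField.classNumber K)
    (hLt : (W.quadraticTwist (NumberField.discr K : ℚ)).entireLFunction 1 ≠ 0)
    (hP : WeierstrassCurve.Affine.Point.map ιC.toRatAlgHom P = heegnerPointComplex Dt H)
    (hc : ¬ (p : ℤ) ∣ Dt.c) : IndexIdentityAt W p K P := by
  haveI : Finite (W.baseChange K).sha :=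
    finite_sha_baseChange_of_heegner W N K Dt H ιC P hGZ hKo hmod hr hK hHN hLt hP
  obtain ⟨hrQ, hShaQ⟩ := hGZK W hr.le
  rw [hr] at hrQ
  obtain ⟨hrk, hfinp⟩ :=
    mordellWeilRank_baseChange_eq_one_and_finite_sha_of_twist_L_one_ne_zero hGZK W K hK p hrQ hShaQ hLt
  have hPinf : ¬ IsOfFinAddOrder P :=
    not_isOfFinAddOrder_of_heegner_of_analyticRank_eq_one W N K Dt H ιC P hGZ hmod hr hK hHN hLt hP
  have hHN' : SatisfiesHeegnerHypothesis (W.conductorNorm ℤ) K := by rw [hN]; exact hHN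
  have hirrK : (W.baseChange K).HasIrreducibleModPGaloisRep p := h.irr_baseChange_of_heegner hK hHN' hHp
  obtain ⟨κ, γ, 𝔭, hκ, hγ, h𝔭⟩ := exists_anticyclotomic_generator_prime (p := p) hK
  haveI : Fact (κ.IsTopGenerator γ) := ⟨hγ⟩
  have hsplit : SplitsIn K p := hHp p Fact.out (dvd_refl p)
  obtain ⟨he, hf⟩ := degreeOne_of_splitsIn hK.1 hsplit h𝔭
  set ι : K →+* ℚ_[p] := embAt K p 𝔭 h𝔭 he hf with hι
  have hCTL : ControlOnTreeGoodAt p κ (inducedPlace ι) γ ι P :=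
    controlOnTreeGoodAt_of_thm331_of_inducedPlace h331 h.three_le h.good hK hHp hN hHN hirrK ι κ hκ γ
      hrk hfinp P hPinf
  have hIW : IMCWaldspurgerOnTreeGoodAt p κ (inducedPlace ι) γ ι P :=
    h.imcWaldspurgerOnTreeGoodAt_inducedPlace_of_yz26_of_cor46_of_thm331 h57 h46 h331 hK hodd h3 hN
      hHN hHp hh ι κ hκ γ Dt hc H ιC P hP hrk hfinp hPinf
  exact indexIdentityAt_of_onTreeGoodLinks_of_allSplit hK hN hHN hIW hCTL

/-- **The same identity on class X10b at `p = 3`** (`ClassX10 W p`, `¬ Surj W 3`, non-CM, `3` split,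
`3 ∤ h_K`): the X10b reading of `indexIdentityAt_of_heegner_of_thm412_of_thm331` with Yan–Zhu 4.12's
(Im)-at-`3` REPLACED by the Howard road (`h57` ∘ `h46`), so NO Wuthrich / (Im) input.
[cite: YanZhu2024MainConjNonCM, Thm. 5.7 (1), Thm. 5.9, proof of Thm. 5.11 (§5.2)] [cite: MastellaZerman2026, Cor. 4.6]
[cite: JetchevSkinnerWan2017, Thm. 3.3.1] [cite: GrossLMS1991, §2 Conj. (2.2)] [cite: Kolyvagin1990, Thm. A] -/
theorem _root_.Literature.NumberTheory.EllipticCurves.Rank1Residual.ClassX10.indexIdentityAt_of_heegner_of_yz26_of_cor46_of_thm331_of_not_surj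
    (h57 : thm57_thm59_bcs422_cgls513_generator_constantCoeff_of_heegnerDivisibility)
    (h46 : cor46_howardDivisibility_of_scalarImage.{0}) (h331 : thm331_anticyclotomicControl)
    (hGZ : gross_zagier N W K) (hKo : kolyvagin N W K) (hmod : hasEntireLFunction_rat)
    (hGZK : rank_eq_analyticRank_of_analyticRank_le_one)
    (h : ClassX10 W p) (hns : ¬ Surj W 3) (hCM : ¬ W.HasCM) (hr : W.analyticRank = 1)
    (hN : W.conductorNorm ℤ = N) (hK : IsImaginaryQuadratic K) (hodd : Odd (NumberField.discr K))
    (h3 : NumberField.discr K ≠ -3) (hHN : SatisfiesHeegnerHypothesis N K)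
    (hHp : SatisfiesHeegnerHypothesis p K) (hh : ¬ p ∣ NumberField.classNumber K)
    (hLt : (W.quadraticTwist (NumberField.discr K : ℚ)).entireLFunction 1 ≠ 0)
    (hP : WeierstrassCurve.Affine.Point.map ιC.toRatAlgHom P = heegnerPointComplex Dt H)
    (hc : ¬ (p : ℤ) ∣ Dt.c) : IndexIdentityAt W p K P := by
  haveI : Finite (W.baseChange K).sha :=
    finite_sha_baseChange_of_heegner W N K Dt H ιC P hGZ hKo hmod hr hK hHN hLt hP
  obtain ⟨hrQ, hShaQ⟩ := hGZK W hr.le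
  rw [hr] at hrQ
  obtain ⟨hrk, hfinp⟩ :=
    mordellWeilRank_baseChange_eq_one_and_finite_sha_of_twist_L_one_ne_zero hGZK W K hK p hrQ hShaQ hLt
  have hPinf : ¬ IsOfFinAddOrder P :=
    not_isOfFinAddOrder_of_heegner_of_analyticRank_eq_one W N K Dt H ιC P hGZ hmod hr hK hHN hLt hP
  have hHN' : SatisfiesHeegnerHypothesis (W.conductorNorm ℤ) K := by rw [hN]; exact hHN
  have hirrK : (W.baseChange K).HasIrreducibleModPGaloisRep p := h.irr_baseChange_of_heegner hK hHN' hHp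
  obtain ⟨κ, γ, 𝔭, hκ, hγ, h𝔭⟩ := exists_anticyclotomic_generator_prime (p := p) hK
  haveI : Fact (κ.IsTopGenerator γ) := ⟨hγ⟩
  have hsplit : SplitsIn K p := hHp p Fact.out (dvd_refl p)
  obtain ⟨he, hf⟩ := degreeOne_of_splitsIn hK.1 hsplit h𝔭
  set ι : K →+* ℚ_[p] := embAt K p 𝔭 h𝔭 he hf with hι
  have hCTL : ControlOnTreeGoodAt p κ (inducedPlace ι) γ ι P :=
    controlOnTreeGoodAt_of_thm331_of_inducedPlace h331 h.three_le h.goodOrd.1 hK hHp hN hHN hirrK ι κ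
      hκ γ hrk hfinp P hPinf
  have hIW : IMCWaldspurgerOnTreeGoodAt p κ (inducedPlace ι) γ ι P :=
    h.imcWaldspurgerOnTreeGoodAt_inducedPlace_of_yz26_of_cor46_of_thm331_of_not_surj h57 h46 h331 hns
      hCM hK hodd h3 hN hHN hHp hh ι κ hκ γ Dt hc H ιC P hP hrk hfinp hPinf
  exact indexIdentityAt_of_onTreeGoodLinks_of_allSplit hK hN hHN hIW hCTL

end Datum

end X11b

end Summit.BirchSwinnertonDyer.Rank1Residual

end
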